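import Mathlib
import HarnessLib

/-!
# Crux `NNLinearDegreeCofactorHard` (stmt-ValiantsHypothesis-23918), line `internal_cofactor`: the conditional-probability
# supermartingale for SINGLE fair coins, with forced and soft-forced coins (pricing (D*-3) of LEAD-HANDOFF §p2)

`…CondProbSupermartingale.lean` (p595799) is indexed by PAIRS of bits (the `inflateWord` decoders).  The ∀c candidate μ* =
`shedWord` (p1 g2) reads ONE fair coin per fair position, and its passage dichotomy (D*-3) is priced by three kinds of coins:
free (`1/2, 1/2`), FORCED (a test: weight `1` on the past-determined legal value, `0` on the other) and SOFT-FORCED (an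
exhaustion gate: `2/3` on the past-determined aligned value, `1/3` on the other — a word failing the gate pays a forced test coin
later, so both branches gain `4/3`).  This file is the single-coin counting lemma and the three weights:

* `sum_prod_condWeightBit_le_one` — for weights `π j v ≥ 0` depending on the bits `≤ j` with `Σ_b π j (v[j := b]) ≤ 1`:
  `Σ_v Π_{j<J} π j v ≤ 1`;  `card_mul_le_one_of_condWeightBit` — hence `#A · w ≤ 1` if every word of `A` has product `≥ w`;
* `sum_forcedWeight_eq`, `sum_softWeight_eq` — the forced and soft weights are conditional probabilities (sum exactly `1`);
* `le_prod_of_pointwise` — bookkeeping: a product of per-coin weights each `≥` a per-coin floor is `≥` the product of floors.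

Honest framing: elementary counting; nothing here proves (D*), S2b, the crux or VP ≠ VNP.  No definitions, no named facts.
-/

-- Sub = Summit single-conjunct layout: the duplicated namespace component is mandated by the tree.
set_option linter.dupNamespace false

namespace Summit.ValiantsHypothesis.ValiantsHypothesis.Theorems.FifoMatching.NNLinearDegreeCofactorHard.CondProbBits

open Finset

variable {J : ℕ}

/-- Setting coin `t` and blanking: `(v̂, b) ↦ v̂[t := b]` is injective on words blank from coin `t` on. [folklore] -/
theorem setBit_injOn (t : ℕ) (ht : t < J) :
    Set.InjOn (fun p : (Fin J → Bool) × Bool => fun k : Fin J => if k.val = t then p.2 else p.1 k)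
      ((((univ : Finset (Fin J → Bool)).filter fun v => ∀ i : Fin J, t ≤ i.val → v i = false)
        ×ˢ (univ : Finset Bool) : Finset _) : Set ((Fin J → Bool) × Bool)) := by
  intro p hp q hq hpq
  rw [mem_coe, mem_product, mem_filter] at hp hq
  have e0 := congrFun hpq ⟨t, ht⟩
  simp only [if_true] at e0
  apply Prod.ext
  · funext k
    by_cases hk : t ≤ k.val
    · rw [hp.1.2 k hk, hq.1.2 k hk]
    · have e := congrFun hpq k
      simp only [show ¬ (k.val = t) by omega, if_false] at e
      exact e
  · exact e0

/-- **A product of conditional sub-probabilities is a sub-probability (single coins).**  Let `π j v ≥ 0` depend on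
`v : Fin J → Bool` only through the bits `≤ j`, with `π j (v[j := false]) + π j (v[j := true]) ≤ 1` for every `j < J` and `v`.
Then `Σ_v Π_{j<J} π j v ≤ 1`. [folklore] -/
theorem sum_prod_condWeightBit_le_one (π : ℕ → (Fin J → Bool) → ℝ) (hπ : ∀ j v, 0 ≤ π j v)
    (hmeas : ∀ j (v w : Fin J → Bool), (∀ i : Fin J, i.val ≤ j → v i = w i) → π j v = π j w)
    (hsub : ∀ j < J, ∀ v : Fin J → Bool,
      ∑ b : Bool, π j (fun k : Fin J => if k.val = j then b else v k) ≤ 1) :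
    ∑ v : Fin J → Bool, ∏ j ∈ range J, π j v ≤ 1 := by
  classical
  suffices S : ∀ t ≤ J, ∑ v ∈ (univ : Finset (Fin J → Bool)).filter
      (fun v => ∀ i : Fin J, t ≤ i.val → v i = false), ∏ j ∈ range t, π j v ≤ 1 by
    have h := S J le_rfl
    rwa [filter_true_of_mem (fun v _ i hi => absurd i.isLt (not_lt.2 hi))] at h
  intro t
  induction t with
  | zero =>
    intro _
    have hsub1 : ((univ : Finset (Fin J → Bool)).filter fun v => ∀ i : Fin J, 0 ≤ i.val → v i = false)
        ⊆ {fun _ => false} := by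
      intro v hv
      rw [mem_filter] at hv
      rw [mem_singleton]
      funext i
      exact hv.2 i (Nat.zero_le _)
    calc ∑ v ∈ (univ : Finset (Fin J → Bool)).filter
          (fun v => ∀ i : Fin J, 0 ≤ i.val → v i = false), ∏ j ∈ range 0, π j v
        ≤ ∑ v ∈ ({fun _ => false} : Finset (Fin J → Bool)), ∏ j ∈ range 0, π j v :=
          sum_le_sum_of_subset_of_nonneg hsub1 (fun v _ _ => by simp)
      _ = 1 := by simp
  | succ t ih =>
    intro ht
    have ht' : t < J := by omega
    set Bt := (univ : Finset (Fin J → Bool)).filter (fun v => ∀ i : Fin J, t ≤ i.val → v i = false) with hBt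
    set Bt1 := (univ : Finset (Fin J → Bool)).filter (fun v => ∀ i : Fin J, t + 1 ≤ i.val → v i = false) with hBt1
    set F : (Fin J → Bool) × Bool → (Fin J → Bool) := fun p k => if k.val = t then p.2 else p.1 k with hF
    have himage : Bt1 = (Bt ×ˢ (univ : Finset Bool)).image F := by
      ext v
      rw [mem_image]
      constructor
      · intro hv
        rw [hBt1, mem_filter] at hv
        refine ⟨(fun k => if k.val = t then false else v k, v ⟨t, ht'⟩), ?_, ?_⟩
        · rw [mem_product, hBt, mem_filter]
          refine ⟨⟨mem_univ _, fun i hi => ?_⟩, mem_univ _⟩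
          simp only
          by_cases h : i.val = t
          · rw [if_pos h]
          · rw [if_neg h]; exact hv.2 i (by omega)
        · funext k
          simp only [hF]
          by_cases h0 : k.val = t
          · rw [if_pos h0]; congr 1; exact Fin.ext h0.symm
          · rw [if_neg h0, if_neg h0]
      · rintro ⟨p, hp, rfl⟩
        rw [mem_product, hBt, mem_filter] at hp
        rw [hBt1, mem_filter]
        refine ⟨mem_univ _, fun i hi => ?_⟩
        simp only [hF]
        rw [if_neg (by omega)]
        exact hp.1.2 i (by omega)
    have hinj : Set.InjOn F ((Bt ×ˢ (univ : Finset Bool) : Finset _) : Set _) := by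
      rw [hF, hBt]; exact setBit_injOn t ht'
    rw [himage, sum_image hinj, sum_product]
    have hfib : ∀ v ∈ Bt, ∑ b : Bool, ∏ j ∈ range (t + 1), π j (F (v, b)) ≤ ∏ j ∈ range t, π j v := by
      intro v _
      have hagree : ∀ b : Bool, ∀ j < t, π j (F (v, b)) = π j v := by
        intro b j hj
        apply hmeas
        intro i hi
        simp only [hF]
        rw [if_neg (by omega)]
      have hrw : ∀ b : Bool, ∏ j ∈ range (t + 1), π j (F (v, b)) = (∏ j ∈ range t, π j v) * π t (F (v, b)) := by
        intro b
        rw [prod_range_succ, prod_congr rfl fun j hj => hagree b j (mem_range.1 hj)]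
      rw [Finset.sum_congr rfl fun b _ => hrw b, ← mul_sum]
      have h1 : ∑ b : Bool, π t (F (v, b)) ≤ 1 := hsub t (by omega) v
      have h0 : 0 ≤ ∏ j ∈ range t, π j v := prod_nonneg fun j _ => hπ j v
      calc (∏ j ∈ range t, π j v) * ∑ b : Bool, π t (F (v, b))
          ≤ (∏ j ∈ range t, π j v) * 1 := mul_le_mul_of_nonneg_left h1 h0
        _ = ∏ j ∈ range t, π j v := mul_one _
    exact (sum_le_sum hfib).trans (ih (by omega))

/-- **Pricing a set of words** (single coins). [folklore] -/
theorem card_mul_le_one_of_condWeightBit (π : ℕ → (Fin J → Bool) → ℝ) (hπ : ∀ j v, 0 ≤ π j v)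
    (hmeas : ∀ j (v w : Fin J → Bool), (∀ i : Fin J, i.val ≤ j → v i = w i) → π j v = π j w)
    (hsub : ∀ j < J, ∀ v : Fin J → Bool,
      ∑ b : Bool, π j (fun k : Fin J => if k.val = j then b else v k) ≤ 1)
    (A : Finset (Fin J → Bool)) (w : ℝ) (hA : ∀ v ∈ A, w ≤ ∏ j ∈ range J, π j v) :
    (A.card : ℝ) * w ≤ 1 := by
  classical
  calc (A.card : ℝ) * w = ∑ v ∈ A, w := by rw [sum_const, nsmul_eq_mul]
    _ ≤ ∑ v ∈ A, ∏ j ∈ range J, π j v := sum_le_sum hA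
    _ ≤ ∑ v : Fin J → Bool, ∏ j ∈ range J, π j v :=
        sum_le_sum_of_subset_of_nonneg (subset_univ A) (fun v _ _ => prod_nonneg fun j _ => hπ j v)
    _ ≤ 1 := sum_prod_condWeightBit_le_one π hπ hmeas hsub

/-! ### The three weights -/

/-- The FORCED coin (a test): weight `1` on the forced value, `0` on the other, is a conditional probability. [folklore] -/
theorem sum_forcedWeight_eq (f : Bool) :
    ∑ b : Bool, (if b = f then (1 : ℝ) else 0) = 1 := by
  cases f <;> simp

/-- The SOFT-FORCED coin (an exhaustion gate): weight `2/3` on the aligned value, `1/3` on the other, is a conditional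
probability; the aligned branch gains `4/3` over the free weight `1/2`, the misaligned branch loses `2/3` and regains `2` at the
forced test coin it causes (`2/3 · 2 = 4/3`). [folklore] -/
theorem sum_softWeight_eq (f : Bool) :
    ∑ b : Bool, (if b = f then (2 / 3 : ℝ) else 1 / 3) = 1 := by
  cases f <;> simp <;> norm_num

/-- The gains, spelled out: `2/3 = (4/3)·(1/2)`, `1 = 2·(1/2)`, `(1/3)·1 = (4/3)·(1/2)·(1/2)`. [folklore] -/
theorem softWeight_gains :
    (2 / 3 : ℝ) = 4 / 3 * (1 / 2) ∧ (1 : ℝ) = 2 * (1 / 2) ∧ (1 / 3 : ℝ) * 1 = 4 / 3 * ((1 / 2) * (1 / 2)) := by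
  norm_num

/-- Bookkeeping: a product of nonnegative per-coin weights, each at least a per-coin floor, is at least the product of the
floors. [folklore] -/
theorem le_prod_of_pointwise {n : ℕ} (f g : ℕ → ℝ) (hg : ∀ j < n, 0 ≤ g j) (h : ∀ j < n, g j ≤ f j) :
    ∏ j ∈ range n, g j ≤ ∏ j ∈ range n, f j :=
  prod_le_prod (fun j hj => hg j (mem_range.1 hj)) (fun j hj => h j (mem_range.1 hj))

end Summit.ValiantsHypothesis.ValiantsHypothesis.Theorems.FifoMatching.NNLinearDegreeCofactorHard.CondProbBits
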